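import Summits.Ventures.HSemireg.WedgeHankelBoxSiegelIdealKernel

/-!
# Venture HSemireg — THE BOX SIEGEL IDEAL, instances: THE BOX OF MIDDLE POWERS `E_{p₀} ⊠ ⋯ ⊠ E_{p_{n−1}}` (`k ≤ p_i ≤ m_i − k`) SEES EXACTLY THE BOX
# SIEGEL IDEAL on `HT^k` — the full-rank criterion of (2/3) attained; degree 2: `ker = SiegelBox` for all `m_i ≥ 4` (gen 10's «NOT typed» line closed)

HONEST FRAMING. Part of the Lean index of the computation cell `pub-hsemireg` (seat p10 gen 12, Sunday typer «UNIFORM-IN-n»).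
Finite-dimensional EXTERIOR ALGEBRA over a field + ranks of Hankel matrices + binomial arithmetic ONLY: no variety, no cohomology theory, no sheaf, no Ext
group, no semiregularity map; nothing here says that HC / HC_CM / HC_AV holds; no Literature fact is declared or used.  Custodian versions as in
`WedgeHankelBoxSiegelIdeal` (1/3); the dictionary (`Θ_i^p/p! ↦ δ_p ↦ E_p = w_{m_i}(δ_p)`; `⌟(v₀ ⊠ ⋯ ⊠ v_{n−1})` ↦ `θ ↦ θ ∧ (v₀ ∧ ⋯ ∧ v_{n−1})`) is QUOTED, never asserted.

THIS FILE (namespace `Summit.Ventures.HSemireg.Wedge.HankelBoxSiegelIdeal` continued; imports (2/3) `WedgeHankelBoxSiegelIdealKernel`):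
* §14 Hankel matrices of a power: for `b ≤ p ≤ m − b` the catalecticant `H_b(δ_p) = ([i + s = p])_{i ≤ b, s ≤ m−b}` has its `b+1` rows equal to DISTINCT unit
  vectors, hence **`rank_hankel1_spike_full`: rank `H_b(δ_p) = b + 1`** (gen 11's `rank_hankel1_delta` is `p = b`); so **`coeff_hankelPoly_spike`: `[t^b] H_m(δ_p) =
  (b+1)·C(m,b) = [t^b] G_m`** for every `b ≤ min(p, m − p)`; a truncation lemma for products (`coeff_prod_congr_of_le`); hence **`coeff_prod_hankelPoly_middle`:
  `[t^k] Π_i H_{m_i}(δ_{p_i}) = [t^k] Π_i G_{m_i}` whenever `k ≤ p_i ≤ m_i − k` for all `i`**.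
* §15 **`ker_wedge_middleBox_eq`: for `n ≥ 1` and `k ≤ p_i ≤ m_i − k` (all `i`) the kernel of `θ ↦ θ ∧ (E_{p₀} ∧ ⋯ ∧ E_{p_{n−1}})` on `⋀^k` IS `boxSiegelIdeal_k`**
  (the full-rank criterion `ker_wedge_hankelBox_eq_iff` of (2/3)); its rank is the generic `[t^k] Π_i G_{m_i}` (`finrank_range_wedge_middleBox`) and its
  kernel dimension `C(Σ 2m_i, k) − [t^k] Π_i G_{m_i}` — so up to the middle degree (`2k ≤ min_i m_i`) a SINGLE box detects the box Siegel ideal (beyond it none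
  can: a factor with `2k > m_i` has `rank H_k(q_i) ≤ m_i + 1 − k < k + 1` for every `q_i`).  Degree 2: **`ker_wedge_middleBox_two_eq_siegelBox`: for all `m_i ≥ 4`
  and `2 ≤ p_i ≤ m_i − 2` the degree-2 kernel is gen 10's `SiegelBox = ⊕_i emb_i(Siegel_{m_i})`, nothing more** — the equality recorded as «numerically forced …
  NOT typed» in `WedgeHankelBoxSiegel` (629), now a theorem (one factor: gen 10's `ker_eq_siegel_of_finrank` / gen 11's `ker_wedge_delta_eq_siegelIdeal`).
* v1.1: **`ker_wedge_hankelBox_eq_of_full_rank`** — the same conclusion for ARBITRARY factor classes whose catalecticants `H_b(q_i)`, `b ≤ k`, all have full row rank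
  (`finrank_range_wedge_hankelBox_of_full_rank`: generic rank), and `coeff_eq_of_ker_eq` (the criterion restated).
NOT typed (honest): which NON-monomial box classes attain the criterion (Zariski-open in the `q_i`); anything Ext-side.  Class side only.
-/

open Module Polynomial

namespace Summit.Ventures.HSemireg.Wedge.HankelBoxSiegelIdeal

open Summit.Ventures.HSemireg.Wedge Summit.Ventures.HSemireg.Wedge.Kunneth Summit.Ventures.HSemireg.Wedge.MixedBox
  Summit.Ventures.HSemireg.Wedge.HankelSiegel Summit.Ventures.HSemireg.Wedge.HankelSiegelIdeal
  Summit.Ventures.HSemireg.Wedge.HankelBox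

variable (K : Type*) [Field K]

/-! ## §14. The catalecticants of a power `Θ^p/p!` have full row rank up to the middle -/

/-- **`rank H_b(δ_p) = b + 1` for `b ≤ p ≤ m − b`**: row `i` of `([i + s = p])_{i ≤ b, s ≤ m − b}` is the unit vector at column `p − i` (all present, all distinct). -/
theorem rank_hankel1_spike_full {m b p : ℕ} (hbp : b ≤ p) (hpm : p + b ≤ m) :
    (Hankel.hankel1 K m b (fun j => if j = p then (1 : K) else 0)).rank = b + 1 := by
  let e : Fin (b + 1) → Fin (m + 1 - b) := fun i => ⟨p - i, by omega⟩
  have he : Function.Injective e := by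
    intro i j h
    have h' := congrArg Fin.val h
    simp only [e] at h'
    exact Fin.ext (by omega)
  have hrow : (Hankel.hankel1 K m b (fun j => if j = p then (1 : K) else 0)).row = ⇑(Pi.basisFun K (Fin (m + 1 - b))) ∘ e := by
    funext i s
    simp only [Function.comp_apply, Matrix.row, Hankel.hankel1, Matrix.of_apply, Pi.basisFun_apply, Pi.single_apply, e, Fin.ext_iff]
    by_cases h : (i : ℕ) + s = p
    · rw [if_pos h, if_pos (by omega)]
    · rw [if_neg h, if_neg (by omega)]
  rw [Matrix.rank_eq_finrank_span_row, hrow, finrank_span_eq_card ((Pi.basisFun K (Fin (m + 1 - b))).linearIndependent.comp e he),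
    Fintype.card_fin]

/-- **`[t^b] H_m(δ_p) = (b+1)·C(m,b) = [t^b] G_m`** for `b ≤ p` and `p + b ≤ m`: up to the middle the power `Θ^p/p!` has the GENERIC Hankel coefficients. -/
theorem coeff_hankelPoly_spike {m b p : ℕ} (hbp : b ≤ p) (hpm : p + b ≤ m) :
    (hankelPoly K m (fun j => if j = p then (1 : K) else 0)).coeff b = (stdPoly m).coeff b := by
  rw [coeff_hankelPoly, coeff_stdPoly, rank_hankel1_spike_full K hbp hpm, mul_comm]

/-- truncation: if two families of polynomials agree coefficientwise up to degree `k`, so do their products (finite products over `Fin n`). -/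
lemma coeff_prod_congr_of_le {n : ℕ} (P Q : Fin n → Polynomial ℕ) {k : ℕ} (h : ∀ i, ∀ b ≤ k, (P i).coeff b = (Q i).coeff b) :
    ∀ b ≤ k, (∏ i, P i).coeff b = (∏ i, Q i).coeff b := by
  induction n with
  | zero => intro b _; simp
  | succ n ih =>
    intro b hb
    rw [Fin.prod_univ_castSucc, Fin.prod_univ_castSucc, coeff_mul, coeff_mul]
    refine Finset.sum_congr rfl fun x hx => ?_
    have hx' := Finset.HasAntidiagonal.mem_antidiagonal.mp hx
    rw [ih (fun i => P (Fin.castSucc i)) (fun i => Q (Fin.castSucc i)) (fun i c hc => h _ c hc) x.1 (by omega),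
      h _ x.2 (by omega)]

/-- **`[t^k] Π_i H_{m_i}(δ_{p_i}) = [t^k] Π_i G_{m_i}` whenever `k ≤ p_i ≤ m_i − k` for every factor** (only coefficients of degree `≤ k` enter). -/
theorem coeff_prod_hankelPoly_middle {n : ℕ} (m : Fin n → ℕ) {k : ℕ} {p : Fin n → ℕ} (hp : ∀ i, k ≤ p i ∧ p i + k ≤ m i) :
    (∏ i : Fin n, hankelPoly K (m i) (fun j => if j = p i then (1 : K) else 0)).coeff k = (∏ i : Fin n, stdPoly (m i)).coeff k :=
  coeff_prod_congr_of_le _ _ (fun i b hb => coeff_hankelPoly_spike K (by have := hp i; omega) (by have := hp i; omega)) k le_rfl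

/-! ## §15. The box of middle powers sees exactly the box Siegel ideal -/

section Box

variable {n : ℕ} (m : Fin n → ℕ)

/-- **THE BOX OF MIDDLE POWERS SEES EXACTLY THE BOX SIEGEL IDEAL: for `n ≥ 1` and `k ≤ p_i ≤ m_i − k` (all `i`),
`ker(θ ↦ θ ∧ (E_{p₀} ∧ ⋯ ∧ E_{p_{n−1}}) ∣ ⋀^k) = boxSiegelIdeal_k`** (read inside `⋀^k`; every field, every dimensions). -/
theorem ker_wedge_middleBox_eq (hn : 1 ≤ n) {k : ℕ} {p : Fin n → ℕ} (hp : ∀ i, k ≤ p i ∧ p i + k ≤ m i) :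
    LinearMap.ker (wedge K (Gen m) k (hankelBox K m fun i => fun j => if j = p i then (1 : K) else 0)) =
      (boxSiegelIdeal K m k).comap (⋀[K]^k (Gen m → K)).subtype :=
  (ker_wedge_hankelBox_eq_iff K m hn _ k).mpr (coeff_prod_hankelPoly_middle K m hp)

/-- … so a `k`-form is in the box Siegel ideal iff the ONE box of middle powers kills it (`2k ≤ min_i m_i` makes such `p` exist). -/
theorem mem_boxSiegelIdeal_iff_mul_middleBox (hn : 1 ≤ n) {k : ℕ} {p : Fin n → ℕ} (hp : ∀ i, k ≤ p i ∧ p i + k ≤ m i)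
    {θ : HT K (Gen m)} (hθ : θ ∈ ⋀[K]^k (Gen m → K)) :
    θ ∈ boxSiegelIdeal K m k ↔ θ * hankelBox K m (fun i => fun j => if j = p i then (1 : K) else 0) = 0 := by
  refine ⟨fun h => mul_hankelBox_eq_zero_of_mem_boxSI K m h _, fun h => ?_⟩
  have hker : (⟨θ, hθ⟩ : ⋀[K]^k (Gen m → K)) ∈
      LinearMap.ker (wedge K (Gen m) k (hankelBox K m fun i => fun j => if j = p i then (1 : K) else 0)) := by
    rw [LinearMap.mem_ker, wedge, LinearMap.comp_apply, Submodule.subtype_apply, LinearMap.mulRight_apply]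
    exact h
  rw [ker_wedge_middleBox_eq K m hn hp] at hker
  exact hker

/-- **the box of middle powers has the GENERIC rank `[t^k] Π_i G_{m_i}` on `⋀^k`** (the largest rank any Hankel box attains there). -/
theorem finrank_range_wedge_middleBox (hn : 1 ≤ n) {k : ℕ} {p : Fin n → ℕ} (hp : ∀ i, k ≤ p i ∧ p i + k ≤ m i) :
    finrank K (LinearMap.range (wedge K (Gen m) k (hankelBox K m fun i => fun j => if j = p i then (1 : K) else 0))) =
      (∏ i : Fin n, stdPoly (m i)).coeff k := by
  rw [finrank_range_wedge_hankelBox K m hn, coeff_prod_hankelPoly_middle K m hp]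

/-- … and kernel dimension `C(Σ_i 2m_i, k) − [t^k] Π_i G_{m_i}` (`= dim boxSiegelIdeal_k`). -/
theorem finrank_ker_wedge_middleBox (hn : 1 ≤ n) {k : ℕ} {p : Fin n → ℕ} (hp : ∀ i, k ≤ p i ∧ p i + k ≤ m i) :
    finrank K (LinearMap.ker (wedge K (Gen m) k (hankelBox K m fun i => fun j => if j = p i then (1 : K) else 0))) =
      finrank K (boxSiegelIdeal K m k) := by
  rw [ker_wedge_middleBox_eq K m hn hp, finrank_comap_boxSiegelIdeal]

/-- every Hankel box has rank AT MOST the middle-power rank on `⋀^k` (the box Siegel ideal lies in every kernel). -/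
theorem finrank_range_wedge_hankelBox_le (hn : 1 ≤ n) (q : Fin n → ℕ → K) (k : ℕ) :
    finrank K (LinearMap.range (wedge K (Gen m) k (hankelBox K m q))) ≤ (∏ i : Fin n, stdPoly (m i)).coeff k := by
  rw [finrank_range_wedge_hankelBox K m hn]
  exact coeff_prod_hankelPoly_le K m hn q k

/-- **DEGREE 2 — gen 10's «numerically forced, NOT typed» equality, now a theorem: for all `m_i ≥ 4` and `2 ≤ p_i ≤ m_i − 2` the kernel of
`θ ↦ θ ∧ (E_{p₀} ∧ ⋯ ∧ E_{p_{n−1}})` on `⋀²` is EXACTLY gen 10's product Siegel space `SiegelBox = ⊕_i emb_i(Siegel_{m_i})`.** -/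
theorem ker_wedge_middleBox_two_eq_siegelBox (hn : 1 ≤ n) {p : Fin n → ℕ} (hp : ∀ i, 2 ≤ p i ∧ p i + 2 ≤ m i) :
    LinearMap.ker (wedge K (Gen m) 2 (hankelBox K m fun i => fun j => if j = p i then (1 : K) else 0)) =
      (siegelBox K m).comap (⋀[K]^2 (Gen m → K)).subtype := by
  rw [ker_wedge_middleBox_eq K m hn hp, boxSiegelIdeal_two]

/-- in particular the box of the MIDDLE powers `Θ_i^{⌊m_i/2⌋}/⌊m_i/2⌋!` sees exactly `boxSiegelIdeal_k` on `⋀^k` for every `k` with `2k ≤ min_i m_i`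
(stated with the hypothesis `2k ≤ m_i` for all `i`). -/
theorem ker_wedge_halfBox_eq (hn : 1 ≤ n) {k : ℕ} (hk : ∀ i, k + k ≤ m i) :
    LinearMap.ker (wedge K (Gen m) k (hankelBox K m fun i => fun j => if j = m i / 2 then (1 : K) else 0)) =
      (boxSiegelIdeal K m k).comap (⋀[K]^k (Gen m → K)).subtype :=
  ker_wedge_middleBox_eq K m hn fun i => by have := hk i; omega

/-! ### v1.1 — the same for ARBITRARY factor classes with full-rank catalecticants up to degree `k` -/

/-- **FULL ROW RANK UP TO DEGREE `k` ON EVERY FACTOR ⇒ THE KERNEL IS THE BOX SIEGEL IDEAL**: if for every factor `i` and every `b ≤ k` the catalecticant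
`H_b(q_i)` has rank `b + 1`, then `ker(θ ↦ θ ∧ (v₀ ∧ ⋯ ∧ v_{n−1}) ∣ ⋀^k) = boxSiegelIdeal_k` (`n ≥ 1`; the middle powers of §15 are the instance `q_i = δ_{p_i}`; the
hypothesis forces `2k ≤ m_i`, since `H_b(q_i)` has only `m_i + 1 − b` columns). -/
theorem ker_wedge_hankelBox_eq_of_full_rank (hn : 1 ≤ n) {k : ℕ} {q : Fin n → ℕ → K}
    (hq : ∀ i, ∀ b ≤ k, (Hankel.hankel1 K (m i) b (q i)).rank = b + 1) :
    LinearMap.ker (wedge K (Gen m) k (hankelBox K m q)) = (boxSiegelIdeal K m k).comap (⋀[K]^k (Gen m → K)).subtype :=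
  (ker_wedge_hankelBox_eq_iff K m hn q k).mpr (coeff_prod_congr_of_le _ _
    (fun i b hb => by rw [coeff_hankelPoly, coeff_stdPoly, hq i b hb, mul_comm]) k le_rfl)

/-- … and then the box has the GENERIC rank `[t^k] Π_i G_{m_i}` on `⋀^k`. -/
theorem finrank_range_wedge_hankelBox_of_full_rank (hn : 1 ≤ n) {k : ℕ} {q : Fin n → ℕ → K}
    (hq : ∀ i, ∀ b ≤ k, (Hankel.hankel1 K (m i) b (q i)).rank = b + 1) :
    finrank K (LinearMap.range (wedge K (Gen m) k (hankelBox K m q))) = (∏ i : Fin n, stdPoly (m i)).coeff k := by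
  rw [finrank_range_wedge_hankelBox K m hn, coeff_prod_congr_of_le (fun i => hankelPoly K (m i) (q i)) (fun i => stdPoly (m i))
    (fun i b hb => by rw [coeff_hankelPoly, coeff_stdPoly, hq i b hb, mul_comm]) k le_rfl]

/-- conversely, **if some factor has `2k > m_i` then NO box has kernel `boxSiegelIdeal_k` on `⋀^k`** is NOT claimed here; what IS immediate: the criterion can only hold when
every relevant catalecticant coefficient is generic — if `ker = boxSiegelIdeal_k` then `[t^k] Π_i H_{m_i}(q_i) = [t^k] Π_i G_{m_i}` (restated from (2/3) for reference). -/
theorem coeff_eq_of_ker_eq (hn : 1 ≤ n) {k : ℕ} {q : Fin n → ℕ → K}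
    (h : LinearMap.ker (wedge K (Gen m) k (hankelBox K m q)) = (boxSiegelIdeal K m k).comap (⋀[K]^k (Gen m → K)).subtype) :
    (∏ i : Fin n, hankelPoly K (m i) (q i)).coeff k = (∏ i : Fin n, stdPoly (m i)).coeff k :=
  (ker_wedge_hankelBox_eq_iff K m hn q k).mp h

end Box

end Summit.Ventures.HSemireg.Wedge.HankelBoxSiegelIdeal
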